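import Literature.Geometry.Riemannian.MetricFlowCorrespondence
import Literature.Geometry.Riemannian.MetricFlowFDistanceSelf
import Literature.Geometry.Riemannian.MetricWedgeFamily
import HarnessLib

/-!
# `𝔽`-convergence implies `𝔽`-convergence within a correspondence (Bamler 2023, §6.2, Thm. 6.4)

R. Bamler, *Compactness theory of the space of super Ricci flows*, Invent. Math. 233 (2023), §6.2,
Theorem 6.4 (arXiv v1 Thm. 128): *"Let `(𝒳^i, (μ^i_t))`, `i ∈ ℕ ∪ {∞}`, be metric flow pairs over
an interval `I` that are fully defined over some `J ⊂ I`. Suppose that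
`d^J_𝔽((𝒳^i, (μ^i_t)), (𝒳^∞, (μ^∞_t))) → 0`. Then there is a correspondence `ℭ` between the metric
flows `𝒳^i`, `i ∈ ℕ ∪ {∞}`, over `I` that is fully defined over `J` such that
`(𝒳^i, (μ^i_t)) → (𝒳^∞, (μ^∞_t))` within `ℭ`, uniformly over `J`."* Proof (source): choose
correspondences `ℭ^{i∞}` between `𝒳^i, 𝒳^∞` over `I`, fully defined over `J`, with
`d^{ℭ^{i∞},J}_𝔽 → 0`, and combine them into one correspondence between all flows (iterated
Lemma 5.15 and a direct limit; equivalently, Remark 6.2, the wedge of all comparison spaces along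
the limit's slices).

This file proves the theorem (`exists_familyCorrespondence_fConvergesWithin`) for the tree's
vocabulary (`MetricFlow.FamilyCorrespondence`, `MetricFlowPair.FConvergesWithin`,
`MetricFlowCorrespondence.lean`; `fDist`, `fDistWithin`, `MetricFlowFDistance.lean`):

* `MetricFlowPair.kuratowskiCorrespondence P Q` — a correspondence between ANY two metric flow
  pairs over `I₀` (both families of slices embedded into `ℓ^∞(ℕ, ℝ)` by Kuratowski embeddings,
  as in `MetricFlowFDistanceSelf.lean`), fully defined over every `J` over which both pairs are
  fully defined — used for the (irrelevant) indices with `d^J_𝔽 = ∞`;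
* `MetricFlowPair.exists_correspondence_fDistWithin_le` — near-optimal correspondences:
  `d^{ℭ,J}_𝔽 ≤ d^J_𝔽 + ε`;
* `MetricFlowPair.TimeWedge` / `timeWedge` / `wedgeCorrespondence` — the family correspondence
  over `Option ℕ` (`none = ∞`): at each time `t ∈ I₀` the metric wedge (`metricWedge`,
  `MetricWedgeFamily.lean`) of all `Zⁿ_t` along the copies `φ^{n,2}_t(𝒳^∞_t)` of the limit's
  slice (the hub; `Zⁿ_t` takes part in the gluing exactly when `t ∈ I''^{n,2}`), with
  `dom (some n) := I''^{n,1} ∩ I''^{n,2}`, `dom none := I'^{,∞}`, `φ (some n) := ιⁿ ∘ φ^{n,1}`,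
  `φ none := hub`;
* `MetricFlowPair.fDistWithin_wedgeCorrespondence_pair_le` — the induced pair correspondence
  `(𝒳ⁿ, 𝒳^∞)` is not worse than `ℭⁿ`: the same exceptional set and couplings are admissible, the
  integrand being pointwise smaller (`ιⁿ_s` is an isometric embedding with
  `ιⁿ_s ∘ φ^{n,2}_s = hub_s`, `wassersteinW1_map_le_of_edist_le`; no measurability is needed);
* `exists_familyCorrespondence_fConvergesWithin` — **Thm. 6.4**.

No `H`-concentration is needed. What is NOT here: the refinements of Thm. 6.4 (uniformity over an
increasing sequence `J_k`, convergence on compact time-intervals, Thm. 6.6).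

## References

* R. H. Bamler, *Compactness theory of the space of super Ricci flows*, Invent. Math. 233 (2023),
  1121–1277 (arXiv:2008.09298), §5.1 Def. 5.5, 5.6, 5.8; §6.1 Def. 6.1, Remark 6.2; §6.2,
  Thm. 6.4 (arXiv v1 Thm. 128) and its proof. [Bamler2023]
-/

noncomputable section

open Set MeasureTheory Filter TopologicalSpace Function
open scoped Topology ENNReal NNReal

namespace Literature.Geometry.Riemannian

universe u

namespace MetricFlowPair

open MetricFlow

variable {I₀ : Set ℝ}

/-! ### A correspondence between any two metric flow pairs -/

/-- **The Kuratowski correspondence between two metric flow pairs over `I₀`**: comparison spaces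
`ℓ^∞(ℕ, ℝ)` at all times, domains `I'^{,1}`, `I'^{,2}`, and the Kuratowski embeddings of the
(separable) slices (`MetricFlowPair.selfEmbedding`). It is fully defined over every `J` over which
both pairs are fully defined. [cite: Bamler2023, §5.1, Def. 5.5 (Correspondence)] -/
def kuratowskiCorrespondence (P Q : MetricFlowPair.{u} I₀) : Correspondence₂ P.flow Q.flow I₀ where
  Z := fun _ ↦ SelfSpace.{u}
  dom₁ := P.I'
  dom₂ := Q.I'
  dom₁_subset := fun _ ht ↦ ⟨ht, P.subset ht⟩
  dom₂_subset := fun _ ht ↦ ⟨ht, Q.subset ht⟩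
  φ₁ := fun t ht ↦ P.selfEmbedding ⟨t, ht⟩
  φ₂ := fun t ht ↦ Q.selfEmbedding ⟨t, ht⟩
  isometry₁ := fun t ht ↦ P.isometry_selfEmbedding ⟨t, ht⟩
  isometry₂ := fun t ht ↦ Q.isometry_selfEmbedding ⟨t, ht⟩

/-- The Kuratowski correspondence is fully defined over `J` if both pairs are.
[cite: Bamler2023, §5.1, Def. 5.5 (Correspondence)] -/
theorem kuratowskiCorrespondence_fullyDefinedOver {P Q : MetricFlowPair.{u} I₀} {J : Set ℝ}
    (hP : P.FullyDefinedOver J) (hQ : Q.FullyDefinedOver J) :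
    (kuratowskiCorrespondence P Q).FullyDefinedOver J :=
  ⟨hP, hQ⟩

/-- **Near-optimal correspondences**: for `ε > 0` there is a correspondence over `I₀`, fully
defined over `J`, with `d^{ℭ,J}_𝔽(P, Q) ≤ d^J_𝔽(P, Q) + ε` (the infimum defining `d^J_𝔽`, Bamler
2023, Def. 5.8; when `d^J_𝔽 = ∞` any correspondence fully defined over `J` will do).
[cite: Bamler2023, §5.1, Def. 5.8 (F-distance); §6.2, proof of Thm. 6.4] -/
theorem exists_correspondence_fDistWithin_le {P Q : MetricFlowPair.{u} I₀} {J : Set ℝ}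
    (hP : P.FullyDefinedOver J) (hQ : Q.FullyDefinedOver J) {ε : ℝ≥0∞} (hε : 0 < ε) :
    ∃ ℭ : Correspondence₂ P.flow Q.flow I₀, ℭ.FullyDefinedOver J ∧
      fDistWithin P Q ℭ J ≤ fDist J P Q + ε := by
  by_cases htop : fDist J P Q = ⊤
  · exact ⟨kuratowskiCorrespondence P Q, kuratowskiCorrespondence_fullyDefinedOver hP hQ,
      by rw [htop, top_add]; exact le_top⟩
  · have hlt : fDist J P Q < fDist J P Q + ε := ENNReal.lt_add_right htop hε.ne'
    obtain ⟨ℭ, hℭ⟩ := iInf_lt_iff.1 hlt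
    obtain ⟨hJ, hlt'⟩ := iInf_lt_iff.1 hℭ
    exact ⟨ℭ, hJ, hlt'.le⟩

/-! ### The wedge correspondence of a sequence of pairwise correspondences with the limit -/

variable (P : ℕ → MetricFlowPair.{u} I₀) (Pinf : MetricFlowPair.{u} I₀)
  (ℭ : ∀ n, Correspondence₂ (P n).flow Pinf.flow I₀)

/-- **The comparison space at time `t` of the wedge correspondence, bundled**: a metric space
with isometric copies of all `Zⁿ_t` and (if `t ∈ I'^{,∞}`) of the limit's slice `𝒳^∞_t`, the copy
`φ^{n,2}_t(𝒳^∞_t) ⊆ Zⁿ_t` being identified with it whenever `t ∈ I''^{n,2}`.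
[cite: Bamler2023, §6.1, Remark 6.2; §6.2, proof of Thm. 6.4] -/
structure TimeWedge (t : I₀) : Type (u + 1) where
  /-- The wedge `Z_t`. -/
  carrier : Type u
  /-- Its metric. -/
  [metric : MetricSpace carrier]
  /-- The isometric copies of the `Zⁿ_t`. -/
  ι : ∀ n, (ℭ n).Z t → carrier
  /-- Each `ι n` is an isometric embedding. -/
  isometry_ι : ∀ n, Isometry (ι n)
  /-- The isometric copy of the limit's slice (for `t ∈ I'^{,∞}`). -/
  hub : ∀ h : (t : ℝ) ∈ Pinf.I', Pinf.flow.Slice ⟨t, h⟩ → carrier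
  /-- `hub` is an isometric embedding. -/
  isometry_hub : ∀ h, Isometry (hub h)
  /-- For `t ∈ I''^{n,2}` the copy `φ^{n,2}_t(𝒳^∞_t)` is the hub. -/
  comm : ∀ n (h₂ : (t : ℝ) ∈ (ℭ n).dom₂) (x : Pinf.flow.Slice ⟨t, ((ℭ n).dom₂_subset h₂).1⟩),
    ι n ((ℭ n).φ₂ t h₂ x) = hub ((ℭ n).dom₂_subset h₂).1 x

attribute [instance] TimeWedge.metric

/-- The disjoint union of the `Zⁿ_t` (`Metric.Sigma.metricSpace`), used at times
`t ∉ I'^{,∞}` where there is no hub to glue along. [cite: Bamler2023, §6.1, Remark 6.2] -/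
def TimeWedge.sigma (t : I₀) (hI : (t : ℝ) ∉ Pinf.I') : TimeWedge P Pinf ℭ t := by
  letI : MetricSpace (Σ n, (ℭ n).Z t) := Metric.Sigma.metricSpace
  exact
    { carrier := Σ n, (ℭ n).Z t
      metric := Metric.Sigma.metricSpace
      ι := fun n z ↦ ⟨n, z⟩
      isometry_ι := fun n ↦ Metric.Sigma.isometry_mk (E := fun k ↦ (ℭ k).Z t) n
      hub := fun h ↦ (hI h).elim
      isometry_hub := fun h ↦ (hI h).elim
      comm := fun n h₂ _ ↦ (hI ((ℭ n).dom₂_subset h₂).1).elim }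

/-- **The comparison space at time `t`**: for `t ∈ I'^{,∞}` the metric wedge (`metricWedge`) of
the `Zⁿ_t`, `n ∈ ℕ`, along the copies `φ^{n,2}_t(𝒳^∞_t)` of the hub `𝒳^∞_t` (`n` active iff
`t ∈ I''^{n,2}`); for `t ∉ I'^{,∞}` the disjoint union of the `Zⁿ_t` (`Metric.Sigma.metricSpace`).
[cite: Bamler2023, §6.1, Remark 6.2; §6.2, proof of Thm. 6.4] -/
def timeWedge (t : I₀) : TimeWedge P Pinf ℭ t := by
  classical
  exact if hI : (t : ℝ) ∈ Pinf.I' then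
    { carrier := (metricWedge (H := Pinf.flow.Slice ⟨t, hI⟩) (Y := fun n ↦ (ℭ n).Z t)
        (Act := fun n ↦ (t : ℝ) ∈ (ℭ n).dom₂) (ψ := fun n h ↦ (ℭ n).φ₂ t h)
        (fun n h ↦ (ℭ n).isometry₂ t h)).carrier
      metric := inferInstance
      ι := (metricWedge fun n h ↦ (ℭ n).isometry₂ (t : ℝ) h).ι
      isometry_ι := (metricWedge fun n h ↦ (ℭ n).isometry₂ (t : ℝ) h).isometry_ι
      hub := fun _ ↦ (metricWedge fun n h ↦ (ℭ n).isometry₂ (t : ℝ) h).hub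
      isometry_hub := fun _ ↦ (metricWedge fun n h ↦ (ℭ n).isometry₂ (t : ℝ) h).isometry_hub
      comm := fun n h₂ x ↦ (metricWedge fun n h ↦ (ℭ n).isometry₂ (t : ℝ) h).comm n h₂ x }
  else TimeWedge.sigma P Pinf ℭ t hI

/-- **The wedge correspondence** between all the flows `𝒳ⁿ`, `n ∈ ℕ`, and `𝒳^∞` over `I₀`
(indexed by `Option ℕ`, `none = ∞`) obtained from correspondences `ℭⁿ` between `𝒳ⁿ` and `𝒳^∞`
over `I₀` (Bamler 2023, §6.2, proof of Thm. 6.4): comparison spaces the wedges `Z_t` (with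
their Borel σ-algebras), `I''^{,n} := I''^{n,1} ∩ I''^{n,2}`, `I''^{,∞} := I'^{,∞}`,
`φⁿ_t := ιⁿ_t ∘ φ^{n,1}_t`, `φ^∞_t := hub_t`. [cite: Bamler2023, §6.2, proof of Thm. 6.4 (arXiv v1 Thm. 128)] -/
def wedgeCorrespondence : FamilyCorrespondence (fun o : Option ℕ ↦ (o.elim Pinf P).flow) I₀ where
  Z t := (timeWedge P Pinf ℭ t).carrier
  instMetricSpace t := (timeWedge P Pinf ℭ t).metric
  instMeasurableSpace t := borel (timeWedge P Pinf ℭ t).carrier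
  instBorelSpace t := @BorelSpace.mk _ _ (borel (timeWedge P Pinf ℭ t).carrier) rfl
  dom o := o.elim Pinf.I' fun n ↦ (ℭ n).dom₁ ∩ (ℭ n).dom₂
  dom_subset o := match o with
    | none => fun _ ht ↦ ⟨ht, Pinf.subset ht⟩
    | some n => fun _ ht ↦ (ℭ n).dom₁_subset ht.1
  φ o := match o with
    | none => fun t ht ↦ (timeWedge P Pinf ℭ ⟨t, Pinf.subset ht⟩).hub ht
    | some n => fun t ht ↦
        (timeWedge P Pinf ℭ ⟨t, ((ℭ n).dom₁_subset ht.1).2⟩).ι n ∘ (ℭ n).φ₁ t ht.1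
  isometry o := match o with
    | none => fun t ht ↦ (timeWedge P Pinf ℭ ⟨t, Pinf.subset ht⟩).isometry_hub ht
    | some n => fun t ht ↦
        ((timeWedge P Pinf ℭ ⟨t, ((ℭ n).dom₁_subset ht.1).2⟩).isometry_ι n).comp
          ((ℭ n).isometry₁ t ht.1)

/-- The wedge correspondence is fully defined over `J` if all `ℭⁿ` and the limit pair are.
[cite: Bamler2023, §6.2, proof of Thm. 6.4 (arXiv v1 Thm. 128)] -/
theorem wedgeCorrespondence_fullyDefinedOver {J : Set ℝ} (hℭ : ∀ n, (ℭ n).FullyDefinedOver J)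
    (hPinf : Pinf.FullyDefinedOver J) : (wedgeCorrespondence P Pinf ℭ).FullyDefinedOver J := by
  intro o
  cases o with
  | none => exact hPinf
  | some n => exact fun x hx ↦ ⟨(hℭ n).1 hx, (hℭ n).2 hx⟩

/-- **The integrand of the induced pair correspondence `(𝒳ⁿ, 𝒳^∞)` is at most that of `ℭⁿ`**:
for `s ≤ t` in `I''^{n,1} ∩ I''^{n,2}`,
`d^{Z_s}_{W₁}((ιⁿ_s ∘ φ^{n,1}_s)_* ν, (hub_s)_* ν') ≤ d^{Zⁿ_s}_{W₁}((φ^{n,1}_s)_* ν, (φ^{n,2}_s)_* ν')`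
— `hub_s = ιⁿ_s ∘ φ^{n,2}_s` on `𝒳^∞_s` and `ιⁿ_s` is an isometric embedding
(`wassersteinW1_map_le_of_edist_le`). [cite: Bamler2023, §6.2, proof of Thm. 6.4 (arXiv v1 Thm. 128)] -/
theorem kernelDistWithin_wedgeCorrespondence_le (n : ℕ) {s t : ℝ} (hs₁ : s ∈ (ℭ n).dom₁)
    (hs₂ : s ∈ (ℭ n).dom₂) (ht₁ : t ∈ (ℭ n).dom₁) (ht₂ : t ∈ (ℭ n).dom₂)
    (p : (P n).flow.Slice ⟨t, ((ℭ n).dom₁_subset ht₁).1⟩ ×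
      Pinf.flow.Slice ⟨t, ((ℭ n).dom₂_subset ht₂).1⟩) :
    kernelDistWithin (P n) Pinf ((wedgeCorrespondence P Pinf ℭ).pair (some n) none)
        (show s ∈ (ℭ n).dom₁ ∩ (ℭ n).dom₂ from ⟨hs₁, hs₂⟩) ((ℭ n).dom₂_subset hs₂).1
        (show t ∈ (ℭ n).dom₁ ∩ (ℭ n).dom₂ from ⟨ht₁, ht₂⟩) ((ℭ n).dom₂_subset ht₂).1 p ≤
      kernelDistWithin (P n) Pinf (ℭ n) hs₁ hs₂ ht₁ ht₂ p := by
  set W := timeWedge P Pinf ℭ ⟨s, ((ℭ n).dom₁_subset hs₁).2⟩ with hW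
  let L : (ℭ n).Z ⟨s, ((ℭ n).dom₁_subset hs₁).2⟩ →
      (wedgeCorrespondence P Pinf ℭ).Z ⟨s, ((ℭ n).dom₁_subset hs₁).2⟩ := W.ι n
  have hL : Isometry L := W.isometry_ι n
  have hLm : Measurable L := hL.continuous.measurable
  have hφ₁m : Measurable ((ℭ n).φ₁ s hs₁) := ((ℭ n).isometry₁ s hs₁).continuous.measurable
  have hφ₂m : Measurable ((ℭ n).φ₂ s hs₂) := ((ℭ n).isometry₂ s hs₂).continuous.measurable
  have hhub : (W.hub ((ℭ n).dom₂_subset hs₂).1 : Pinf.flow.Slice _ → _) = L ∘ (ℭ n).φ₂ s hs₂ :=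
    funext fun x ↦ (W.comm n hs₂ x).symm
  show wassersteinW1
      (((P n).flow.condKernel p.1 ⟨s, ((ℭ n).dom₁_subset hs₁).1⟩).map (L ∘ (ℭ n).φ₁ s hs₁))
      ((Pinf.flow.condKernel p.2 ⟨s, ((ℭ n).dom₂_subset hs₂).1⟩).map
        (W.hub ((ℭ n).dom₂_subset hs₂).1)) ≤
    wassersteinW1 (((P n).flow.condKernel p.1 ⟨s, ((ℭ n).dom₁_subset hs₁).1⟩).map
        ((ℭ n).φ₁ s hs₁))
      ((Pinf.flow.condKernel p.2 ⟨s, ((ℭ n).dom₂_subset hs₂).1⟩).map ((ℭ n).φ₂ s hs₂))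
  rw [hhub, ← Measure.map_map hLm hφ₁m, ← Measure.map_map hLm hφ₂m]
  exact wassersteinW1_map_le_of_edist_le hLm (fun x y ↦ (hL.edist_eq x y).le) _ _

/-- **`d^{ℭ.pair n ∞, J}_𝔽(𝒳ⁿ, 𝒳^∞) ≤ d^{ℭⁿ, J}_𝔽(𝒳ⁿ, 𝒳^∞)`** for the wedge correspondence: every radius
admissible for `ℭⁿ` is admissible for the induced pair correspondence, with the same exceptional
set and couplings (the integrand is pointwise smaller, `kernelDistWithin_wedgeCorrespondence_le`).
[cite: Bamler2023, §6.2, proof of Thm. 6.4 (arXiv v1 Thm. 128)] -/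
theorem fDistWithin_wedgeCorrespondence_pair_le (n : ℕ) (J : Set ℝ) :
    fDistWithin (P n) Pinf ((wedgeCorrespondence P Pinf ℭ).pair (some n) none) J ≤
      fDistWithin (P n) Pinf (ℭ n) J := by
  refine le_fDistWithin_iff.2 fun r hr ↦ fDistWithin_le ?_
  obtain ⟨hr, E, hEm, hEI, hJ, hE₁, hE₂, hvol, q, hq, hint⟩ := hr
  refine ⟨hr, E, hEm, hEI, hJ, fun t ht ↦ ⟨hE₁ ht, hE₂ ht⟩,
    fun t ht ↦ ((ℭ n).dom₂_subset (hE₂ ht)).1, hvol, q, hq, fun s hs t ht hst ↦ ?_⟩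
  exact (lintegral_mono fun p ↦ kernelDistWithin_wedgeCorrespondence_le P Pinf ℭ n (hE₁ hs)
    (hE₂ hs) (hE₁ ht) (hE₂ ht) p).trans (hint s hs t ht hst)

end MetricFlowPair

/-! ### Thm. 6.4 -/

/-- **Bamler 2023, Thm. 6.4 (arXiv v1 Thm. 128): `𝔽`-convergence implies `𝔽`-convergence within a
correspondence.** Let `P n`, `n ∈ ℕ`, and `Pinf` be metric flow pairs over `I₀`, all fully
defined over `J`, with `d^J_𝔽(P n, Pinf) → 0`. Then there is ONE correspondence `ℭ` between all
the flows `(P n).flow`, `Pinf.flow` over `I₀` (indexed by `Option ℕ`, `none = ∞`), fully defined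
over `J`, within which `P n → Pinf` uniformly over `J`
(`MetricFlowPair.FConvergesWithin`: `d^{ℭ.pair n ∞, J}_𝔽(P n, Pinf) → 0`). Proof as in the source:
near-optimal correspondences `ℭⁿ` between `𝒳ⁿ` and `𝒳^∞`
(`exists_correspondence_fDistWithin_le`, `d^{ℭⁿ,J}_𝔽 ≤ d^J_𝔽 + n⁻¹`) combined into the wedge
correspondence along the limit's slices (`wedgeCorrespondence`; Remark 6.2 / Lemma 5.15 and a
direct limit, `MetricWedgeFamily.lean`), within which
`d^{ℭ.pair n ∞,J}_𝔽 ≤ d^{ℭⁿ,J}_𝔽 ≤ d^J_𝔽 + n⁻¹ → 0`.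
[cite: Bamler2023, §6.2, Thm. 6.4 (arXiv v1 Thm. 128)] -/
theorem exists_familyCorrespondence_fConvergesWithin {I₀ : Set ℝ}
    (P : ℕ → MetricFlowPair.{u} I₀) (Pinf : MetricFlowPair.{u} I₀) (J : Set ℝ)
    (hP : ∀ n, (P n).FullyDefinedOver J) (hPinf : Pinf.FullyDefinedOver J)
    (h : Tendsto (fun n ↦ MetricFlowPair.fDist J (P n) Pinf) atTop (𝓝 0)) :
    ∃ ℭ : MetricFlow.FamilyCorrespondence (fun o : Option ℕ ↦ (o.elim Pinf P).flow) I₀,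
      ℭ.FullyDefinedOver J ∧ MetricFlowPair.FConvergesWithin P Pinf ℭ J := by
  -- near-optimal correspondences `ℭⁿ`
  have hex : ∀ n : ℕ, ∃ ℭ : MetricFlow.Correspondence₂ (P n).flow Pinf.flow I₀,
      ℭ.FullyDefinedOver J ∧ MetricFlowPair.fDistWithin (P n) Pinf ℭ J ≤
        MetricFlowPair.fDist J (P n) Pinf + (n : ℝ≥0∞)⁻¹ := fun n ↦
    MetricFlowPair.exists_correspondence_fDistWithin_le (hP n) hPinf
      (ENNReal.inv_pos.2 (ENNReal.natCast_ne_top n))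
  choose ℭ hℭJ hℭd using hex
  refine ⟨MetricFlowPair.wedgeCorrespondence P Pinf ℭ,
    MetricFlowPair.wedgeCorrespondence_fullyDefinedOver P Pinf ℭ hℭJ hPinf, ?_⟩
  -- `d^{pair,J} ≤ d^{ℭⁿ,J} ≤ d^J_𝔽 + n⁻¹ → 0`
  have hlim : Tendsto (fun n : ℕ ↦ MetricFlowPair.fDist J (P n) Pinf + (n : ℝ≥0∞)⁻¹) atTop
      (𝓝 0) := by
    simpa only [add_zero] using h.add ENNReal.tendsto_inv_nat_nhds_zero
  exact tendsto_of_tendsto_of_tendsto_of_le_of_le tendsto_const_nhds hlim (fun _ ↦ zero_le)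
    fun n ↦ (MetricFlowPair.fDistWithin_wedgeCorrespondence_pair_le P Pinf ℭ n J).trans (hℭd n)

end Literature.Geometry.Riemannian

end
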